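import Literature.NumberTheory.EllipticCurves.IsogenyFrobeniusTraceHoldsProofs
import Literature.NumberTheory.EllipticCurves.IsogenyFaltingsLFunctionProofs
import Literature.NumberTheory.EllipticCurves.ComplexMultiplicationLFunctionIsogenyHoldsProofs
import Literature.NumberTheory.Automorphic.CDTTheorem722ThreeFactsProofs
import Literature.NumberTheory.Automorphic.CDTTheorem712
import Literature.NumberTheory.Automorphic.BCDTModularityModPProofs
import Literature.NumberTheory.EllipticCurves.CuspFormLFunctionLevelConductorOfCarayolProofs
import Literature.NumberTheory.EllipticCurves.CuspFormLFunctionLevelConductorProofs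
import HarnessLib

/-!
# Stub `stub_threeImpTwo` (S9) of line `Sketch`, crux `FreyModularity` (stmt-ABC-11340) — ideator k = 2
# RE-CUT PACKAGE, sorry-free: H4 (Carayol-level for one curve from exponentwise Ogg–Saito),
# H5 (mod-ℓ modularity from a newform at ANY level), H6 (the re-cut composition of
# `isModular_freyCurve_of_atoms` with `h32` replaced by `SomeLevel` + Carayol(A) + Ogg–Saito for the curve).

All imports are Literature leaf modules (the Summits Reshape chain is unbuilt on the farm today);
the Frey-specific inputs of `Summit.ABC.ABC.Theorems.isModular_freyCurve_of_atoms` (Reshape5) enter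
H6 as hypotheses (`h9`, `h25`, `hirrW`, `habs5` = `stub_absIrrSqrtFive`, `h9tr` = `stub_nineTransfer`).
-/

set_option linter.dupNamespace false

noncomputable section

/-! ## H4 -/

open scoped NumberField Polynomial MatrixGroups ModularForm
open NumberField IsDedekindDomain Field Rat.HeightOneSpectrum CongruenceSubgroup
open Literature.NumberTheory.GaloisRepresentations Literature.NumberTheory.EllipticCurves
open Literature.NumberTheory.EllipticCurves.ModularForms
open WeierstrassCurve

namespace Summit.ABC.ABC.Theorems.StubIdeasThreeImpTwoK2H4

variable {N : ℕ} [NeZero N] {W : WeierstrassCurve ℚ} [W.IsElliptic] {f : CuspForm (Gamma0 N) 2}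

/-- (re-proof of the private helper) `m ∈ v ↔ p_v ∣ m`. [folklore] -/
theorem natCast_mem_asIdeal_iff' (v : HeightOneSpectrum (𝓞 ℚ)) (m : ℕ) :
    (m : 𝓞 ℚ) ∈ v.asIdeal ↔ ((primesEquiv v : Nat.Primes) : ℕ) ∣ m := by
  rw [show ((primesEquiv v : Nat.Primes) : ℕ) = natGenerator v from rfl, natGenerator_dvd_iff,
    ← map_natCast (Rat.IsIntegralClosure.intEquiv (𝓞 ℚ)) m, Ideal.apply_mem_of_equiv_iff]

omit [NeZero N] in
/-- (re-proof of the private helper) `N = N_E` exponentwise. [folklore] -/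
theorem eq_conductorNorm_of_forall_padicValNat_eq_conductorExponent' (hN : N ≠ 0)
    (h : ∀ q : ℕ, q.Prime → ∀ w : HeightOneSpectrum (𝓞 ℚ), (q : 𝓞 ℚ) ∈ w.asIdeal →
      padicValNat q N = W.conductorExponent w) :
    N = W.conductorNorm ℤ := by
  refine Nat.eq_of_factorization_eq hN (W.conductorNorm_pos_holds).ne' fun q ↦ ?_
  by_cases hq : q.Prime
  · set q' : Nat.Primes := ⟨q, hq⟩ with hq'
    set w : HeightOneSpectrum (𝓞 ℚ) := (primesEquiv (R := 𝓞 ℚ)).symm q' with hw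
    have hpw : (primesEquiv w : Nat.Primes) = q' := Equiv.apply_symm_apply _ _
    have hqw : (q : 𝓞 ℚ) ∈ w.asIdeal := (natCast_mem_asIdeal_iff' w q).mpr (by rw [hpw])
    have hgen : natGenerator ((primesEquiv (R := ℤ)).symm q') = q :=
      congrArg (fun x : Nat.Primes ↦ (x : ℕ)) (Equiv.apply_symm_apply (primesEquiv (R := ℤ)) q')
    rw [Nat.factorization_def _ hq, h q hq w hqw, W.conductorExponent_ringOfIntegers_eq w,
      ← W.factorization_conductorNorm_holds ((primesEquiv (R := ℤ)).symm (primesEquiv w)), hpw, hgen]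
  · rw [Nat.factorization_eq_zero_of_not_prime _ hq, Nat.factorization_eq_zero_of_not_prime _ hq]

/-- **H4, exponentwise step**: `v_q(N) = f_w(E)` at every prime `q`, granted Carayol's conductor
theorem and the exponentwise Ogg–Saito statement `a_w(V_ℓ E) = f_w(E)` (all `ℓ`, all `w ∤ ℓ`) for
the curve at hand. [cite: DarmonDiamondTaylor1995, Thm. 3.1 (d) with §2.1 (p. 54)] -/
theorem padicValNat_level_eq_conductorExponent_of_carayol1986_of_oggSaito
    (hC : Carayol1986_artinConductorExponent)
    (hOS : ∀ (ℓ : ℕ) [Fact ℓ.Prime], W.artinConductorExponent_tate_eq_conductorExponent_of_isElliptic ℓ)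
    (hf : IsNewformOf W f) {q : ℕ} (hq : q.Prime) (w : HeightOneSpectrum (𝓞 ℚ))
    (hqw : (q : 𝓞 ℚ) ∈ w.asIdeal) :
    padicValNat q N = W.conductorExponent w := by
  obtain ⟨ℓ, hℓ, hqℓ, hirr⟩ := W.exists_prime_gt_isIrreducible_rationalGaloisRepTate q
  haveI := hℓ
  obtain ⟨ι⟩ := PadicAlgCl.nonempty_ringEquiv_complex ℓ
  obtain ⟨ρ, hρ, hirrρ, hcond⟩ := hf.exists_isGaloisRepOfNewform1_rationalTate ℓ ι hirr
  have hnew : IsNewform1 (liftToGamma1 N 2 f) := (isNewform1_liftToGamma1_iff_holds N 2 f).mpr hf.1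
  have hqw' : ((primesEquiv w : Nat.Primes) : ℕ) = q :=
    (Nat.prime_dvd_prime_iff_eq (primesEquiv w).2 hq).mp ((natCast_mem_asIdeal_iff' w q).mp hqw)
  have hℓw : (ℓ : 𝓞 ℚ) ∉ w.asIdeal := by
    rw [natCast_mem_asIdeal_iff', hqw']
    intro h
    exact (ne_of_lt hqℓ) ((Nat.prime_dvd_prime_iff_eq hq hℓ.out).mp h)
  have key := hC (liftToGamma1 N 2 f) le_rfl hnew ℓ ι ρ hρ hirrρ q hq (ne_of_lt hqℓ) w hqw
  rw [← key, hcond w hℓw]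
  exact hOS ℓ _ w hℓw

/-- **H4**: level `=` conductor for ONE curve from Carayol 1986 Thm (A) and exponentwise Ogg–Saito
for that curve. [cite: DiamondShurman2005, Thm. 8.8.1] -/
theorem level_eq_conductorNorm_of_carayol1986_of_oggSaito (hC : Carayol1986_artinConductorExponent)
    (hOS : ∀ (ℓ : ℕ) [Fact ℓ.Prime], W.artinConductorExponent_tate_eq_conductorExponent_of_isElliptic ℓ)
    (hf : IsNewformOf W f) : N = W.conductorNorm ℤ :=
  eq_conductorNorm_of_forall_padicValNat_eq_conductorExponent' (NeZero.ne N) fun _ hq w hqw ↦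
    padicValNat_level_eq_conductorExponent_of_carayol1986_of_oggSaito hC hOS hf hq w hqw

end Summit.ABC.ABC.Theorems.StubIdeasThreeImpTwoK2H4


/-! ## H5 -/

open scoped NumberField Polynomial MatrixGroups ModularForm
open Polynomial IsDedekindDomain

namespace Literature.NumberTheory.Automorphic.BCDT.StubIdeasThreeImpTwoK2H5

open EllipticCurves.ModularForms WeierstrassCurve Rat.HeightOneSpectrum CongruenceSubgroup UpperHalfPlane

/-- A `Γ₀(N)`-newform is non-zero (`a₁ = 1`). [folklore] -/
theorem isNewform0_ne_zero {N : ℕ} [NeZero N] {k : ℤ}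
    {f : CuspForm (Gamma0 N) k} (hf : IsNewform0 f) : f ≠ 0 := by
  intro h
  have h1 : cuspCoeff f 1 = 1 := (isNormalized_iff_cuspCoeff_one f).mp hf.2.2
  rw [h] at h1
  simp [cuspCoeff, UpperHalfPlane.qExpansion_zero] at h1

/-- **H5 with the inputs of the original as hypotheses**: a newform `f ∈ S₂(Γ₀(N))` of `W` at ANY
level `N` makes every framed `ρ̄_{E,ℓ}` modular. [cite: DiamondShurman2005, Thm. 9.4.1]
[cite: BCDTJAMS2001, §2.2 (proof of Thm. 2.2.1)] -/
theorem isModular_torsionGaloisRep_of_isNewformOf_of {W : WeierstrassCurve ℚ} [W.IsElliptic]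
    {N : ℕ} [NeZero N] {f : CuspForm (Gamma0 N) 2} (hf : IsNewformOf W f)
    (hlift : isNewform1_liftToGamma1_iff (N := N) (k := 2))
    {ℓ : ℕ} [Fact ℓ.Prime] (htr : W.trace_galoisRepTate_frobenius_of_hasGoodReductionAt ℓ)
    (hdet : W.det_galoisRepTate_frobenius_of_hasGoodReductionAt ℓ)
    {ρ : GaloisRepresentations.ModPGaloisRep ℚ (ZMod ℓ) 2} (hρ : W.IsTorsionGaloisRep ℓ ρ) :
    ρ.IsModular := by
  classical
  have hℓp : ℓ.Prime := Fact.out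
  obtain ⟨hf0, hcoef⟩ := hf
  have hfne : f ≠ 0 := isNewform0_ne_zero hf0
  -- the newform on `Γ₁(N)` with trivial character
  set f₁ : CuspForm (Gamma1 N) 2 := liftToGamma1 N 2 f with hf₁
  have hnew : IsNewform1 f₁ := (hlift f).mpr hf0
  have hcoe : (⇑f₁ : ℍ → ℂ) = ⇑f := coe_liftToGamma1_holds _ 2 f
  have hε : nebentypus f₁ = 1 := nebentypus_liftToGamma1_holds _ 2 hfne
  -- a prime `𝔪` of the coefficient ring `𝓞_f` above `ℓ`, and `K = 𝓞_f / 𝔪 ⊇ 𝔽_ℓ`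
  haveI : Algebra.IsIntegral ℤ (coeffCharIntegers f₁) := by
    unfold coeffCharIntegers; infer_instance
  haveI hmax : (Ideal.span {(ℓ : ℤ)}).IsMaximal :=
    PrincipalIdealRing.isMaximal_of_irreducible (Nat.prime_iff_prime_int.mp hℓp).irreducible
  obtain ⟨𝔪, h𝔪max, h𝔪⟩ := Ideal.exists_ideal_over_maximal_of_isIntegral
    (S := coeffCharIntegers f₁) (Ideal.span {(ℓ : ℤ)}) (fun x hx ↦ by
      rw [RingHom.mem_ker, eq_intCast, Int.cast_eq_zero] at hx
      rw [hx]; exact Ideal.zero_mem _)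
  haveI : 𝔪.IsMaximal := h𝔪max
  have hℓ𝔪 : ((ℓ : ℕ) : coeffCharIntegers f₁) ∈ 𝔪 := by
    have h : ((ℓ : ℕ) : ℤ) ∈ 𝔪.comap (algebraMap ℤ (coeffCharIntegers f₁)) := by
      rw [h𝔪]; exact Ideal.mem_span_singleton_self _
    rwa [Ideal.mem_comap, map_natCast] at h
  let K : Type := coeffCharIntegers f₁ ⧸ 𝔪
  letI : Field K := Ideal.Quotient.field 𝔪
  letI : TopologicalSpace K := ⊥
  haveI : DiscreteTopology K := ⟨rfl⟩
  have hℓK : ((ℓ : ℕ) : K) = 0 := by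
    rw [← map_natCast (Ideal.Quotient.mk 𝔪), Ideal.Quotient.eq_zero_iff_mem]
    exact hℓ𝔪
  haveI : CharP K ℓ := (CharP.charP_iff_prime_eq_zero hℓp).mpr hℓK
  let j : ZMod ℓ →+* K := ZMod.castHom (dvd_refl ℓ) K
  let ι : coeffCharIntegers f₁ →+* K := Ideal.Quotient.mk 𝔪
  refine ⟨N, inferInstance, 2, f₁, K, inferInstance, inferInstance, inferInstance,
    j, ι, by norm_num, hnew, ?_⟩
  -- `ρ̄ ⊗ K` is attached to `f₁` away from `N ℓ`
  intro v hv
  have hpp : (primesEquiv v : ℕ).Prime := (primesEquiv v).2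
  rw [ZMod.ringChar_zmod_n] at hv
  have hpN : ¬ (primesEquiv v : ℕ) ∣ N := fun h ↦ hv (dvd_mul_of_dvd_left h _)
  have hpℓ : (primesEquiv v : ℕ) ≠ ℓ := fun h ↦ hv (by rw [← h]; exact dvd_mul_left _ _)
  -- THE ONE CHANGED STEP: `p ∤ N ⇒ p ∤ N_E` (`IsNewformOf.dvd_level_iff_dvd_conductorNorm`)
  have hpNW : ¬ (primesEquiv v : ℕ) ∣ W.conductorNorm ℤ := fun h ↦
    hpN ((IsNewformOf.dvd_level_iff_dvd_conductorNorm ⟨hf0, hcoef⟩ hpp).mpr h)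
  have hgood : W.HasGoodReductionAt v := by
    by_contra h
    exact hpNW ((W.dvd_conductorNorm_iff v).mpr h)
  have hℓv : ((ℓ : ℕ) : 𝓞 ℚ) ∉ v.asIdeal := by
    rw [Literature.NumberTheory.GaloisRepresentations.Rat.natCast_mem_asIdeal_iff]
    exact fun h ↦ hpℓ ((Nat.prime_dvd_prime_iff_eq hpp hℓp).mp h)
  refine ⟨?_, ?_⟩
  · -- unramified at `p` (Néron–Ogg–Shafarevich)
    intro 𝔓 h𝔓 τ hτ
    rw [GaloisRepresentations.FramedRep.baseChange_apply, hρ.isUnramifiedAt_of_hasGoodReductionAt hgood hℓv 𝔓 h𝔓 τ hτ,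
      map_one]
  · -- the Hecke polynomial `X² - a_p X + p`, integrally, and the Frobenius characteristic polynomial
    have hap : (qExpansion 1 ⇑f₁).coeff (primesEquiv v : ℕ) =
        ((W.LFunction (primesEquiv v : ℕ) : ℤ) : ℂ) := by
      rw [hcoe]; exact hcoef _
    have hεp : (nebentypus f₁ ((primesEquiv v : ℕ) : ZMod N) : ℂ) *
        ((primesEquiv v : ℕ) : ℂ) ^ ((2 : ℤ) - 1) = ((primesEquiv v : ℕ) : ℂ) := by
      rw [hε, MulChar.one_apply ((ZMod.isUnit_prime_iff_not_dvd hpp).mpr hpN), one_mul]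
      norm_num
    have h1 : (⟨(qExpansion 1 ⇑f₁).coeff (primesEquiv v : ℕ),
        cuspCoeff_mem_coeffCharField f₁ (primesEquiv v : ℕ)⟩ : coeffCharField f₁) =
        ((W.LFunction (primesEquiv v : ℕ) : ℤ) : coeffCharField f₁) :=
      Subtype.ext (by
        change PowerSeries.coeff _ (qExpansion 1 ⇑f₁) = _
        rw [hap]; norm_cast)
    have h2 : (⟨(nebentypus f₁ ((primesEquiv v : ℕ) : ZMod N) : ℂ) *
        ((primesEquiv v : ℕ) : ℂ) ^ ((2 : ℤ) - 1),
        nebentypus_mul_zpow_mem_coeffCharField f₁ (primesEquiv v : ℕ)⟩ : coeffCharField f₁) =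
        ((primesEquiv v : ℕ) : coeffCharField f₁) :=
      Subtype.ext (by
        change (nebentypus f₁ ((primesEquiv v : ℕ) : ZMod N) : ℂ) *
          ((primesEquiv v : ℕ) : ℂ) ^ ((2 : ℤ) - 1) = _
        rw [hεp]; norm_cast)
    refine ⟨X ^ 2 - C ((W.LFunction (primesEquiv v : ℕ) : ℤ) : coeffCharIntegers f₁) * X +
      C ((primesEquiv v : ℕ) : coeffCharIntegers f₁), ?_, ?_⟩
    · rw [Polynomial.map_add, Polynomial.map_sub, Polynomial.map_mul, Polynomial.map_pow,
        Polynomial.map_X, Polynomial.map_C, Polynomial.map_C, map_intCast, map_natCast,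
        EllipticCurves.ModularForms.heckePolynomial, h1, h2]
    · intro 𝔓 h𝔓 σ hσ
      have hch := hρ.charpoly_eq_of_isArithFrobAt htr hdet hℓv hgood h𝔓 hσ
      rw [natCard_residueField_adicCompletionIntegers,
        ← W.lFunction_primesEquiv_eq_frobeniusTraceAt hgood] at hch
      have hmap : (Units.val (Matrix.GeneralLinearGroup.map j (ρ σ)) : Matrix (Fin 2) (Fin 2) K) =
          ((ρ σ : GL (Fin 2) (ZMod ℓ)) : Matrix (Fin 2) (Fin 2) (ZMod ℓ)).map j := rfl
      simp only [GaloisRepresentations.FramedRep.charpoly, GaloisRepresentations.FramedRep.baseChange_apply]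
      rw [hmap, Matrix.charpoly_map, hch]
      simp only [Polynomial.map_add, Polynomial.map_sub, Polynomial.map_mul, Polynomial.map_pow,
        Polynomial.map_X, Polynomial.map_C]
      rw [map_intCast j, map_natCast j, map_intCast ι, map_natCast ι]

/-- **H5**: a newform of `W` at ANY level makes every framed `ρ̄_{E,ℓ}` modular — inputs discharged as
in `IsModular.isModular_of_isTorsionGaloisRep''`. [cite: BCDTJAMS2001, Introduction ((2) ⇒ (4))] -/
theorem isModular_torsionGaloisRep_of_isNewformOf {W : WeierstrassCurve ℚ} [W.IsElliptic]
    {N : ℕ} [NeZero N] {f : CuspForm (Gamma0 N) 2} (hf : IsNewformOf W f)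
    {ℓ : ℕ} [Fact ℓ.Prime] {ρ : GaloisRepresentations.ModPGaloisRep ℚ (ZMod ℓ) 2}
    (hρ : W.IsTorsionGaloisRep ℓ ρ) : ρ.IsModular :=
  isModular_torsionGaloisRep_of_isNewformOf_of hf (isNewform1_liftToGamma1_iff_holds _ 2)
    (W.trace_galoisRepTate_frobenius_of_hasGoodReductionAt_holds ℓ)
    (det_galoisRepTate_frobenius_of_hasGoodReductionAt_of_exists_weilPairing
      fun _ ↦ W.exists_weilPairing_holds _) hρ

end Literature.NumberTheory.Automorphic.BCDT.StubIdeasThreeImpTwoK2H5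


/-! ## H6 — the re-cut composition -/

open scoped MatrixGroups NumberField ModularForm
open NumberField IsDedekindDomain CongruenceSubgroup
open Literature.NumberTheory.EllipticCurves
open Literature.NumberTheory.EllipticCurves.ModularForms
open Literature.NumberTheory.Automorphic
open Literature.NumberTheory.Automorphic.BCDT
open Literature.NumberTheory.GaloisRepresentations
open WeierstrassCurve

namespace Summit.ABC.ABC.Theorems.StubIdeasThreeImpTwoK2Recut

/-- `S_a`: "(3) ⇒ modular at SOME level". -/
def SomeLevel : Prop :=
  ∀ (W : WeierstrassCurve ℚ) [W.IsElliptic] (ℓ : ℕ) [Fact ℓ.Prime], W.IsModularGaloisRepTate ℓ →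
    ∃ (N : ℕ) (_ : NeZero N) (f : CuspForm (Gamma0 N) 2), IsNewformOf W f

/-- H6: **the re-cut composition** (CDT p. 556 run on `W`), `h32` replaced by `h3a`, `hC`, `hOS`. -/
theorem isModular_of_atoms_recut
    (hmod3 : ∀ (W : WeierstrassCurve ℚ) [W.IsElliptic] (ρ : ModPGaloisRep ℚ (ZMod 3) 2),
      W.IsTorsionGaloisRep 3 ρ → FramedRep.IsAbsolutelyIrreducible ρ → ρ.IsModular)
    (hlift3 : ∀ (W : WeierstrassCurve ℚ) [W.IsElliptic] (ρ : ModPGaloisRep ℚ (ZMod 3) 2),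
      W.IsTorsionGaloisRep 3 ρ → ρ.IsAbsIrreducibleOverSqrt (-3) → ¬ 9 ∣ W.conductorNorm ℤ →
      ρ.IsModular → W.IsModularGaloisRepTate 3)
    (hlift5 : ∀ (W : WeierstrassCurve ℚ) [W.IsElliptic] (ρ : ModPGaloisRep ℚ (ZMod 5) 2),
      W.IsTorsionGaloisRep 5 ρ → ρ.IsAbsIrreducibleOverSqrt 5 → ¬ 25 ∣ W.conductorNorm ℤ →
      ρ.IsModular → W.IsModularGaloisRepTate 5)
    (h3a : SomeLevel) (hC : Carayol1986_artinConductorExponent) (hsw : CDT_three_five_switch)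
    -- `stub_absIrrSqrtFive` (Rubin Prop. 7) and `stub_nineTransfer` (Silverberg Prop. 7.1), as registered
    (habs5 : ∀ (V : WeierstrassCurve ℚ) [V.IsElliptic], ¬ 25 ∣ V.conductorNorm ℤ →
      ∀ ρ : ModPGaloisRep ℚ (ZMod 5) 2, V.IsTorsionGaloisRep 5 ρ → FramedRep.IsIrreducible ρ →
        ρ.IsAbsIrreducibleOverSqrt 5)
    (h9tr : ∀ (V V' : WeierstrassCurve ℚ) [V.IsElliptic] [V'.IsElliptic] (ρ : ModPGaloisRep ℚ (ZMod 5) 2),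
      V.IsTorsionGaloisRep 5 ρ → V'.IsTorsionGaloisRep 5 ρ →
      ¬ 9 ∣ V.conductorNorm ℤ → ¬ 9 ∣ V'.conductorNorm ℤ)
    -- the curve: Frey data `9 ∤ N`, `25 ∤ N`, `E[5]` irreducible, and Ogg–Saito for it
    (W : WeierstrassCurve ℚ) [W.IsElliptic] [NeZero (W.conductorNorm ℤ)]
    (h9 : ¬ 9 ∣ W.conductorNorm ℤ) (h25 : ¬ 25 ∣ W.conductorNorm ℤ)
    (hirrW : ∀ ρ : ModPGaloisRep ℚ (ZMod 5) 2, W.IsTorsionGaloisRep 5 ρ → FramedRep.IsIrreducible ρ)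
    (hOS : ∀ (ℓ : ℕ) [Fact ℓ.Prime], W.artinConductorExponent_tate_eq_conductorExponent_of_isElliptic ℓ) :
    BCDT.IsModular W := by
  -- (3) ⇒ (2) for `W` itself: some level (`h3a`) + level = conductor (H4 with `hOS`)
  have h32W : ∀ (ℓ : ℕ) [Fact ℓ.Prime], W.IsModularGaloisRepTate ℓ → BCDT.IsModular W :=
    fun ℓ _ h ↦ by
      obtain ⟨N, hN, f, hf⟩ := h3a W ℓ h
      obtain rfl : N = W.conductorNorm ℤ := Summit.ABC.ABC.Theorems.StubIdeasThreeImpTwoK2H4.level_eq_conductorNorm_of_carayol1986_of_oggSaito hC hOS hf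
      exact ⟨f, hf⟩
  -- case A's chain in GALOIS form, for any curve: `ρ_{V,3}` modular
  have hA3 : ∀ (V : WeierstrassCurve ℚ) [V.IsElliptic] (ρ₃ : ModPGaloisRep ℚ (ZMod 3) 2),
      V.IsTorsionGaloisRep 3 ρ₃ → ρ₃.IsAbsIrreducibleOverSqrt (-3) → ¬ 9 ∣ V.conductorNorm ℤ →
      V.IsModularGaloisRepTate 3 :=
    fun V _ ρ₃ hρ₃ h3i h9V ↦ hlift3 V ρ₃ hρ₃ h3i h9V (hmod3 V ρ₃ hρ₃ h3i.isAbsolutelyIrreducible)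
  by_cases hA : ∃ ρ₃ : ModPGaloisRep ℚ (ZMod 3) 2,
      W.IsTorsionGaloisRep 3 ρ₃ ∧ ρ₃.IsAbsIrreducibleOverSqrt (-3)
  · obtain ⟨ρ₃, hρ₃, h3i⟩ := hA
    exact h32W 3 (hA3 W ρ₃ hρ₃ h3i h9)
  have hB : ∀ ρ₃ : ModPGaloisRep ℚ (ZMod 3) 2, W.IsTorsionGaloisRep 3 ρ₃ →
      ¬ ρ₃.IsAbsIrreducibleOverSqrt (-3) := fun ρ₃ hρ₃ h3i ↦ hA ⟨ρ₃, hρ₃, h3i⟩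
  have h27 : ¬ 27 ∣ W.conductorNorm ℤ := fun h27 ↦ h9 (dvd_trans ⟨3, rfl⟩ h27)
  obtain ⟨ρ, hρ⟩ := W.exists_isTorsionGaloisRep 5
  have h5 : ρ.IsAbsIrreducibleOverSqrt 5 := habs5 W h25 ρ hρ (hirrW ρ hρ)
  -- Wiles' switch from `W` itself
  obtain ⟨W', hW', hρ', ρ₃', hρ₃', h3i'⟩ := hsw W h27 hB ρ hρ h5
  haveI := hW'
  have h9' : ¬ 9 ∣ W'.conductorNorm ℤ := h9tr W W' ρ hρ hρ' h9
  -- `E'` modular AT SOME LEVEL suffices for `ρ̄ = ρ̄_{E',5}` modular (H5)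
  obtain ⟨N', hN', g, hg⟩ := h3a W' 3 (hA3 W' ρ₃' hρ₃' h3i' h9')
  have hρmod : ρ.IsModular := Literature.NumberTheory.Automorphic.BCDT.StubIdeasThreeImpTwoK2H5.isModular_torsionGaloisRep_of_isNewformOf hg hρ'
  exact h32W 5 (hlift5 W ρ hρ h5 h25 hρmod)

end Summit.ABC.ABC.Theorems.StubIdeasThreeImpTwoK2Recut


end
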